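import Literature.AlgebraicGeometry.Pohlmann1968.CMFieldImprimitiveTypeDegreeLeTwelveHodgeConjecture
import Literature.AlgebraicGeometry.HodgeTheory.HodgeConjectureIsogenyInvariance
import Literature.AlgebraicGeometry.Motives.AbelianVarietyPoincareCompleteReducibility
import HarnessLib

/-!
# The Hodge conjecture for the abelian variety ITSELF (spelling `HodgeConjectureFor A.dim A.X`) in the low-degree CM cases: any CM type of a CM
# field of degree `≤ 6`; any non-primitive CM type of a CM field of degree `≤ 12`

Layer `Literature/AlgebraicGeometry/Pohlmann1968`, namespace `Literature.AlgebraicGeometry.Pohlmann1968`; lane `lit-hodgefound` (Track 2 foundations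
library), prover seat `lit-hodgefound-p10`, generation 33, row «A2-26(hm)» (self-proposed 2026-08-28).  Theorems only; no `def`, no instance, no
named fact (net Literature debt 0).

The siblings `CMFieldDegreeLeSixAllPowersHodgeConjecture` and `CMFieldImprimitiveTypeDegreeLeTwelveHodgeConjecture` state the Hodge conjecture for the
powers `Aⁿ = ⨁_{i<n} A` (the biproduct, including `n = 1`).  For a non-abelian CM field the tree's intrinsic transfer
(`forall_pow_hodgeClassSpan_eq_iff_forall_hodgeClassSpan_eq`, abelian fields only) is not available; instead `A ≅ ⨁_{i<1} A`
(`biproductUniqueIso`) is an isogeny and the Hodge conjecture is an isogeny invariant (van Geemen Lemma 3.7, tree `HodgeConjectureFor.of_isIsogenous`).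

* (private `A ∼ ⨁_{i<1} A`), **`hodgeConjectureFor_of_finrank_le_six`** (every abelian variety with complex multiplication
  by a CM field of degree `≤ 6`, any type), **`hodgeConjectureFor_of_not_isPrimitive_of_finrank_le_twelve`**,
  **`hodgeConjectureFor_of_not_isSimple_of_finrank_le_twelve`** (every non-simple abelian variety with complex multiplication by a CM field of
  degree `≤ 12`).

## References

* [vanGeemen1994HodgeAV] B. van Geemen, *An introduction to the Hodge conjecture for abelian varieties* (1994), Lemma 3.7.
* [Gordon1999HodgeAVSurvey] B. B. Gordon (1999), Thm. 6.4, §9.3.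
* [MoonenZarhin1999LowDim] B. Moonen, Yu. Zarhin, Math. Ann. 315 (1999), Thm. 0.1.
-/

noncomputable section

open scoped Classical NumberField
open NumberField Module CategoryTheory CategoryTheory.Limits

namespace Literature.AlgebraicGeometry.Pohlmann1968

-- `open scoped`: the tree's action of `Aut(ℂ)` on `Hom(K, ℂ)` by composition (`ringEquivCompAction`) is a scoped instance
open scoped Literature.NumberTheory.ComplexMultiplication
open Literature.AlgebraicGeometry.Motives (CMType AbelianVariety)
open Literature.AlgebraicGeometry.HodgeTheory
open Literature.NumberTheory.ComplexMultiplication (IsPrimitive)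
open Literature.AlgebraicGeometry.ComplexMultiplication (IsCMTypeRealisation)

variable {K : Type} [Field K] [NumberField K] [IsCMField K]
  {A : AbelianVariety ℂ} {ι : 𝓞 K →+* End A} {θ : K →+* Module.End ℂ (complexBetti A.X 1)}

omit [IsCMField K] in
/-- `A ∼ ⨁_{i<1} A` (indeed isomorphic: `biproductUniqueIso`). [folklore] -/
private theorem isIsogenous_biproduct_fin_one₄₈ (B : AbelianVariety ℂ) :
    Motives.AbelianVariety.IsIsogenous B (⨁ fun _ : Fin 1 => B) :=
  let e : B ≅ ⨁ fun _ : Fin 1 => B := (biproductUniqueIso (fun _ : Fin 1 => B)).symm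
  ⟨e.hom, Motives.AbelianVariety.isIsogeny_hom_of_iso e⟩

/-- **THE HODGE CONJECTURE FOR EVERY ABELIAN VARIETY WITH COMPLEX MULTIPLICATION BY A CM FIELD OF DEGREE `≤ 6`, ANY CM TYPE** (`dim A ≤ 3`;
spelling `HodgeConjectureFor A.dim A.X`). [cite: Gordon1999HodgeAVSurvey, Thm. 6.4 and §9.3] [cite: MoonenZarhin1999LowDim, Thm. 0.1]
[cite: vanGeemen1994HodgeAV, Lemma 3.7] -/
theorem hodgeConjectureFor_of_finrank_le_six (hK : Module.finrank ℚ K ≤ 6) (Φ : CMType K) (hA : IsCMTypeRealisation Φ A ι θ) :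
    HodgeConjectureFor A.dim A.X :=
  HodgeConjectureFor.of_isIsogenous (isIsogenous_biproduct_fin_one₄₈ A) (hodgeConjectureFor_pow_of_finrank_le_six hK Φ hA 1)

/-- **The Hodge conjecture for every realisation of a NON-PRIMITIVE CM type of a CM field of degree `≤ 12`** (spelling `A.dim`).
[cite: Gordon1999HodgeAVSurvey, Thm. 6.4 and §9.3] [cite: vanGeemen1994HodgeAV, Lemma 3.7] -/
theorem hodgeConjectureFor_of_not_isPrimitive_of_finrank_le_twelve (hK : Module.finrank ℚ K ≤ 12) (Φ : CMType K) (φ₀ : K →+* ℂ)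
    (hΦ : ¬ IsPrimitive (ℂ ≃+* ℂ) Φ.1 φ₀) (hA : IsCMTypeRealisation Φ A ι θ) : HodgeConjectureFor A.dim A.X :=
  HodgeConjectureFor.of_isIsogenous (isIsogenous_biproduct_fin_one₄₈ A)
    (hodgeConjectureFor_pow_of_not_isPrimitive_of_finrank_le_twelve hK Φ φ₀ hΦ hA 1)

/-- **THE HODGE CONJECTURE FOR EVERY NON-SIMPLE ABELIAN VARIETY WITH COMPLEX MULTIPLICATION BY A CM FIELD OF DEGREE `≤ 12`** (`dim A ≤ 6`,
`A ∼ B^h`, `h ≥ 2`; spelling `A.dim`). [cite: Gordon1999HodgeAVSurvey, Thm. 6.4 and §9.3] [cite: MoonenZarhin1999LowDim, Thm. 0.1]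
[cite: vanGeemen1994HodgeAV, Lemma 3.7] -/
theorem hodgeConjectureFor_of_not_isSimple_of_finrank_le_twelve (hK : Module.finrank ℚ K ≤ 12) (Φ : CMType K)
    (hA : IsCMTypeRealisation Φ A ι θ) (hns : ¬ A.IsSimple) : HodgeConjectureFor A.dim A.X :=
  HodgeConjectureFor.of_isIsogenous (isIsogenous_biproduct_fin_one₄₈ A)
    (hodgeConjectureFor_pow_of_not_isSimple_of_finrank_le_twelve hK Φ hA hns 1)

end Literature.AlgebraicGeometry.Pohlmann1968

end
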